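import Mathlib
import Literature.RepresentationTheory.FiniteGroups.KLRGradedCellularBasis
import Summits.MatrixMultiplication.MatrixMultiplication.Theorems.SnSubsetDichotomyNoThresholdSubsetTripleAltCornerCharge
import Summits.MatrixMultiplication.MatrixMultiplication.Theorems.SnSubsetDichotomyNoThresholdSubsetTripleTwoMulTableauDegreeStep

/-!
# The pair-sum formula for the Brundan–Kleshchev–Wang degree at `p = 2`

Sub-goal `two_mul_tableauDegree_eq_pairSum` of line `klr-graded-polynomial-method` (crux
`SnSubsetDichotomy.NoThresholdSubsetTriple`, stmt-MatrixMultiplication-8302), the assembly of the two landed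
sub-goals `altCornerCharge_eq` (closed form of the alternating corner charge of a Young diagram) and
`two_mul_tableauDegreeStep_eq` (the degree step is `(1 + π_A · charge)/2`):

for a standard Young tableau `T` of shape `μ ⊢ n` whose entry `k` sits in the cell `T.1 k = (r_k, c_k)`, with
content `u_k = c_k − r_k` and sign `π_k = (−1)^(r_k + c_k)`,

  `2 · deg₂ T = Σ_k [u_k > 0] π_k − Σ_k Σ_(j < k) κ(u_k − u_j) · π_j π_k`,   `κ(d) = 4 (d ≥ 2), 3 (d = 1), 1 (d = 0), 0 (d < 0)`.

All dependence of the degree on the ORDER in which the cells are filled sits in the signed pair count with weight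
`4` (pairs of cells at content distance `≥ 2`, earlier cell of smaller content); the `κ = 3, 1` terms and the first sum are
functions of the shape alone.  This is the mechanism statement behind the open stub `stub_degreeTailSingle` (tail of
`deg₂` of the recording tableau of a random permutation): `deg₂ T = Φ(shape) − 2·I(T)` with `I(T)` a signed inversion
count of the linear extension `T` of the Young diagram.
-/

namespace Summit.MatrixMultiplication.MatrixMultiplication.Theorems

open Literature.RepresentationTheory.FiniteGroups (addableNodes removableNodes prefixCells tableauDegreeStep
  tableauDegree)
open Literature.NumberTheory.DiophantineGeometry (StdFilling)

set_option linter.dupNamespace false in -- deliberate Summit.<S>.<P> duplicate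
/-- **Pair-sum formula for the `p = 2` Brundan–Kleshchev–Wang degree of a standard Young tableau**:
`2·deg₂ T = Σ_k [u_k > 0]π_k − Σ_k Σ_(j<k) κ(u_k − u_j) π_j π_k` (`u` = content, `π = (−1)^(row+col)`,
`κ = 4/3/1/0` according as the content gap is `≥ 2 / = 1 / = 0 / < 0`).  Proof: sum the step identity
`two_mul_tableauDegreeStep_eq` over `k`, evaluate the charge of the prefix shape by `altCornerCharge_eq`
(prefixes of standard tableaux are lower sets, `isLowerSet_prefixCells`), rewrite the sum over the prefix shape as a
sum over the entries `j ≤ k` (injectivity of `T`), and cancel the diagonal term `j = k` (`κ(0)·π_k² = 1`) against the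
leading `1`. [folklore] -/
theorem two_mul_tableauDegree_eq_pairSum : ∀ (n : ℕ) (μ : Nat.Partition n) (T : Literature.NumberTheory.DiophantineGeometry.StdFilling n μ.youngDiagram), 2 * Literature.RepresentationTheory.FiniteGroups.tableauDegree 2 T.1 = ∑ k : Fin n, ((if (0 : ℤ) < ((T.1 k).2 : ℤ) - (T.1 k).1 then (-1 : ℤ) ^ ((T.1 k).1 + (T.1 k).2) else 0) - ∑ j ∈ Finset.univ.filter (fun j : Fin n => j < k), (if 2 ≤ (((T.1 k).2 : ℤ) - (T.1 k).1) - (((T.1 j).2 : ℤ) - (T.1 j).1) then 4 else if (((T.1 k).2 : ℤ) - (T.1 k).1) - (((T.1 j).2 : ℤ) - (T.1 j).1) = 1 then 3 else if (((T.1 k).2 : ℤ) - (T.1 k).1) - (((T.1 j).2 : ℤ) - (T.1 j).1) = 0 then 1 else 0) * (-1 : ℤ) ^ ((T.1 j).1 + (T.1 j).2 + (T.1 k).1 + (T.1 k).2)) := by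
  intro n μ T
  -- abbreviations
  set f := T.1 with hf
  have hinj : Function.Injective f := T.injective
  -- unfold the degree as a sum of steps and work termwise
  unfold Literature.RepresentationTheory.FiniteGroups.tableauDegree
  rw [Finset.mul_sum]
  refine Finset.sum_congr rfl fun k _ => ?_
  have h1 := two_mul_tableauDegreeStep_eq n μ T k
  have h2 := altCornerCharge_eq (prefixCells f k)
    (fun x hx y hyx => isLowerSet_prefixCells T k hyx hx) (((f k).2 : ℤ) - (f k).1)
  rw [h2] at h1
  rw [h1]
  -- the sum over the prefix shape is a sum over the entries `j ≤ k`
  have hsum : ∀ g : ℕ × ℕ → ℤ, (prefixCells f k).sum g =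
      g (f k) + ∑ j ∈ Finset.univ.filter (fun j : Fin n => j < k), g (f j) := by
    intro g
    rw [prefixCells, Finset.sum_image (fun x _ y _ h => hinj h)]
    have hsplit : (Finset.univ.filter fun j : Fin n => j ≤ k) =
        insert k (Finset.univ.filter fun j : Fin n => j < k) := by
      ext j
      simp only [Finset.mem_filter, Finset.mem_univ, true_and, Finset.mem_insert]
      constructor
      · intro h
        exact h.lt_or_eq.symm
      · rintro (rfl | h)
        · exact le_rfl
        · exact h.le
    rw [hsplit, Finset.sum_insert (by simp)]
  rw [hsum]
  -- the diagonal term `j = k` has weight `κ(0) = 1` and sign `π_k`, cancelling the leading `1`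
  have hdiag : (if 2 ≤ ((f k).2 : ℤ) - (f k).1 - (((f k).2 : ℤ) - (f k).1) then (4 : ℤ)
      else if ((f k).2 : ℤ) - (f k).1 - (((f k).2 : ℤ) - (f k).1) = 1 then 3
      else if ((f k).2 : ℤ) - (f k).1 - (((f k).2 : ℤ) - (f k).1) = 0 then 1 else 0) = 1 := by
    simp
  rw [hdiag, one_mul]
  have hsq : ((-1 : ℤ) ^ ((f k).1 + (f k).2)) * (-1 : ℤ) ^ ((f k).1 + (f k).2) = 1 := by
    rw [← pow_add, Even.neg_one_pow ⟨(f k).1 + (f k).2, rfl⟩]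
  -- distribute the sign `π_k` into the inner sum: `π_j · π_k = (-1)^{a_j + a_k}`
  have hinner : (-1 : ℤ) ^ ((f k).1 + (f k).2) *
      ∑ j ∈ Finset.univ.filter (fun j : Fin n => j < k),
        (if 2 ≤ ((f k).2 : ℤ) - (f k).1 - (((f j).2 : ℤ) - (f j).1) then (4 : ℤ)
          else if ((f k).2 : ℤ) - (f k).1 - (((f j).2 : ℤ) - (f j).1) = 1 then 3
          else if ((f k).2 : ℤ) - (f k).1 - (((f j).2 : ℤ) - (f j).1) = 0 then 1 else 0) *
          (-1 : ℤ) ^ ((f j).1 + (f j).2) =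
      ∑ j ∈ Finset.univ.filter (fun j : Fin n => j < k),
        (if 2 ≤ ((f k).2 : ℤ) - (f k).1 - (((f j).2 : ℤ) - (f j).1) then (4 : ℤ)
          else if ((f k).2 : ℤ) - (f k).1 - (((f j).2 : ℤ) - (f j).1) = 1 then 3
          else if ((f k).2 : ℤ) - (f k).1 - (((f j).2 : ℤ) - (f j).1) = 0 then 1 else 0) *
          (-1 : ℤ) ^ ((f j).1 + (f j).2 + (f k).1 + (f k).2) := by
    rw [Finset.mul_sum]
    refine Finset.sum_congr rfl fun j _ => ?_
    rw [add_assoc ((f j).1 + (f j).2) (f k).1 (f k).2, pow_add]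
    ring
  rw [mul_sub, mul_add, hinner]
  split_ifs with hpos
  · linear_combination (-1 : ℤ) * hsq
  · linear_combination (-1 : ℤ) * hsq

end Summit.MatrixMultiplication.MatrixMultiplication.Theorems
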